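import Mathlib
import HarnessLib
import HarnessLib.Audit
import Summits.AtomisticToContinuum.Statement
import Literature.MathematicalPhysics.KineticTheory.InfiniteChainDynamics

/-!
Route: CollisionNoise

CLOSED (retired) 2026-08-15T13:41:18Z by operator:999:1257524 — reason: not-a-thesis: assembly does not conclude the sub-problem Statement — note: D-0027 §2.1 audit (human 2026-08-15: routes that do not decide the summit are removed): the assembly concludes `ArrheniusWindowLaw`, not the sub-problem statement; a NEW conforming route may be opened from the same idea (generated `closes : … → _root_.FouriersLaw`).. The file is kept as the record of this route; refuted decls are indexed as negative knowledge (`ledger negatives`).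

# Route CollisionNoise — Collisions make the noise — Rice–Palm rare-collision kinetic window of the
tethered pinned harmonic chain: Arrhenius law c/ε ≤ D ≤ C/ε for N ≍ L/ε, a rung inside
FouriersLawFor

RUNG ROUTE realising idea card AtomisticToContinuum/FouriersLaw/collisions-make-the-noise (a
toy-model rung stated with the conjunct's own objects `OscillatorChain.IsSteadyState` /
`totalCurrent`; it does NOT imply `FouriersLaw`, which concerns a different chain, and no assembly
to the conjunct is claimed). MODEL: the tethered pinned harmonic chains P_m = ⟨U = ω₂q²/2, V = r²/2
+ r^(2m), γ⟩ (tether at |r| = b = 1 WLOG by the exact conjugacy q ↦ q/b, T ↦ T/b²; m → ∞ is the hard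
tether, at which a hit |q_(x+1) − q_x| = 1 is an elastic equal-mass collision = the momentum
exchange p_x ↔ p_(x+1)). SMALL PARAMETER: the Rice rate of outward hits of |r_x| = 1 by the free
Gibbs–Gaussian stretch, ε(T) = π⁻¹√(2/G)·exp(−1/(2GT)), G(ω₂) = Var(r_x)/T = 1 − √(ω₂/(ω₂+4)). X =
ArrheniusWindowLaw ("Boltzmann–Grad in energy", robust two-sided form): for all ω₂, γ > 0 there are
0 < c and C such that for every macroscopic length L ≥ 1, all small T (then all steep m ≥ M(T)) and
N = ⌈L/ε(T)⌉ + 1 sites between Langevin baths at T ± δ/2: (a) some weak-steady-state family has a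
linear-response coefficient D = lim_δ totalCurrent/δ, and (b) EVERY response coefficient of every
steady family obeys c ≤ ε(T)·D ≤ C — transport on the kinetic window is normal and limited exactly
by the rare collisions, i.e. an Arrhenius conductance law with activation constant 1/(2G(ω₂))
DERIVED from Newton + Gibbs, the tethered analogue of the conjectural (λT)⁻² law of the conjunct's
corner. It suffices to show KineticUpperBound (rank 2, dissipativity of the first-order Palm
collision operator: no log(1/ε) enhancement), SpaceTimeExcursionPoisson (rank 3, the randomness:
rescaled tether hits of the FREE pinned harmonic chain in its Gibbs state form independent rate-1
Poisson streams, jointly over macroscopically separated bond blocks), KineticLowerBound (rank 4,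
collisions cannot do more than rate ε: Mazur/variational side) and the support TetheredSmoothFamily
(a differentiable steady family exists, CEHR-type); Assembly = KineticUpperBound →
SpaceTimeExcursionPoisson → KineticLowerBound → TetheredSmoothFamily → ArrheniusWindowLaw (glue
proved rc0 in the planner sketch, axioms propext/choice/Quot.sound).
Lean: `∀ ω₂ γ : ℝ, 0 < ω₂ → 0 < γ → ∀ G : ℝ, G = 1 - Real.sqrt (ω₂ / (ω₂ + 4)) → ∀ ε : ℝ → ℝ, (∀ T,
ε T = Real.exp (-(1 / (2 * G * T))) * Real.sqrt (2 / G) / Real.pi) → ∃ c C : ℝ, 0 < c ∧ ∀ L : ℝ, 1 ≤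
L → ∃ T₀ : ℝ, 0 < T₀ ∧ ∀ T : ℝ, 0 < T → T < T₀ → ∃ M : ℕ, ∀ m : ℕ, M ≤ m → ∀ P :
Literature.MathematicalPhysics.KineticTheory.HeatConduction.OscillatorChain, P = ⟨fun q => ω₂ * q ^
2 / 2, fun r => r ^ 2 / 2 + r ^ (2 * m), γ⟩ → ∀ N : ℕ, N = ⌈L / ε T⌉₊ + 1 → (∃ μ : ℝ → ℝ →
MeasureTheory.Measure (Literature.MathematicalPhysics.KineticTheory.HeatConduction.PhaseSpace N), (∀
T_L T_R : ℝ, 0 < T_L → 0 < T_R → P.IsSteadyState N T_L T_R (μ T_L T_R)) ∧ ∃ D : ℝ, Filter.Tendsto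
(fun δ : ℝ => P.totalCurrent (μ (T + δ / 2) (T - δ / 2)) / δ) (nhdsWithin 0 {(0 : ℝ)}ᶜ) (nhds D)) ∧
∀ (μ : ℝ → ℝ → MeasureTheory.Measure
(Literature.MathematicalPhysics.KineticTheory.HeatConduction.PhaseSpace N)) (D : ℝ), (∀ T_L T_R : ℝ,
0 < T_L → 0 < T_R → P.IsSteadyState N T_L T_R (μ T_L T_R)) → Filter.Tendsto (fun δ : ℝ =>
P.totalCurrent (μ (T + δ / 2) (T - δ / 2)) / δ) (nhdsWithin 0 {(0 : ℝ)}ᶜ) (nhds D) → c ≤ ε T * D ∧ ε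
T * D ≤ C`

## Assembly
Pure logic, PROVED in the planner sketch (Sketch.lean `assembly_holds`, rc 0, 25 lines): c from
KineticLowerBound, C from KineticUpperBound; for L ≥ 1 take T₀ = min of the two thresholds, for T
the cut-off M = max(M_upper, M_lower, 2); clause (a) is TetheredSmoothFamily at (m, N, T), clause
(b) is the two bounds applied to the given (μ, D). SpaceTimeExcursionPoisson is CARRIED, not
consumed, by the glue: it is the molecular-chaos input of any proof of KineticUpperBound (its first
layer-2 child, § Two-layer plan) and the mechanism's signature claim, filed at layer 1 because it is
provable now and is the cheapest place to kill the line; this is said openly rather than hidden in a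
conditional restatement of the rank-2 crux.

Rationale: WHY THIS LINE. The card's move is to DERIVE the conservative noise of the solvable stochastic
Fourier models (harmonic chain + momentum exchanges, FritzFunakiLebowitz1994, BernardinOlla2005,
BasileBernardinOlla2009, BasileOllaSpohn2009, BasileBernardinJaraKomorowskiOlla2016) from an honest
Hamiltonian OscillatorChain: rare tether hits are exact momentum exchanges, and their statistics
come from the Gibbs–Gaussian field through extreme-value theory (Rice1954, Berman1971, Qualls1968,
LeadbetterLindgrenRootzen1983, Piterbarg2012, Aldous1989) — "Boltzmann–Grad in energy", with
Lanford1975 / Gallavotti1969 as the structural template and the kinetic scale t ≍ N ≍ 1/ε. The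
planner's cheap check CHANGED the identification and is built into the cruxes: at a hit the
Palm/Slepian structure of the Gibbs field (w = C ℓ_ṙ*/λ₂ = −d_x/2, Φ·Cov(q, r_x) = T(e_(x+1) − e_x))
makes the exchange R_x = I + d_x ℓ_ṙ coincide to leading order with the FREE harmonic turnaround
e^(θA), θ = 2Vλ₀/λ₂b → 0 (up-crossing Palm law ↦ down-crossing Palm law exactly), so collisions are
equilibrium-invisible at leading order and act on transport only through the first-order Palm tilt
of a current-carrying perturbation δC (Δq ≈ −(V/T)·δC_pq(e_(x+1) − e_x), Δp ≈ (V/T)·Φ δC_qq(e_(x+1)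
− e_x) − V(δλ₂/λ₂)(e_(x+1) − e_x), V Rayleigh and independent of the residual field): the limit
collision operator is a "Palm-mismatch" operator, NOT the Poisson-exchange (BBO) kernel, and whether
it is dissipative on the odd sector is exactly KineticUpperBound. Imported areas: extreme-value
theory of Gaussian processes and fields (Rice formula, Berman mixing, Slepian/Palm models, Poisson
clumping) and kinetic theory (Lanford-type expansion in the NUMBER of collisions, linear Boltzmann
slab crossover with Langevin contacts, cf. KomorowskiOlla2020); nearest deterministic precedents
derive stochastic exchange from IN-CELL chaos (GaspardGilbert2008, BalintEtAl2015,
KellerLiverani2009) or an EXTERNAL chaotic field (CanestrariLiveraniOlla2026), never from Gibbs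
extremes of an integrable bulk. Unlike KineticCorner (weak 4-phonon nonlinearity of pinnedChain,
nonlinear Boltzmann, resonance analysis) the nonlinearity here is strong but rare and the limit
equation is linear; unlike NoiseHomotopyTransfer no noise is added; unlike DilutePhononLorentzGas
the diluteness is in time, not space. Negatives index: empty at filing.

RANKED CRUXES. #0 ArrheniusWindowLaw (target) — X as in § Thesis: ∀ ω₂ γ > 0 ∃ 0 < c, C ∀ L ≥ 1 ∃ T₀
∀ T ∈ (0, T₀) ∃ M ∀ m ≥ M, with P = P_m, ε = Rice rate, N = ⌈L/ε(T)⌉ + 1: (a) some steady family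
(IsSteadyState at all T_L, T_R > 0) has a response limit D = lim_(δ→0, δ≠0) totalCurrent(μ_(T+δ/2,
T−δ/2))/δ; (b) every response limit of every steady family satisfies c ≤ ε(T)·D ≤ C. (why it might
fail: Upper side: the first-order Palm collision operator may be non-dissipative on the odd sector,
giving εD ~ log(1/ε) → ∞; lower side/finite m: smooth-wall multi-phonon scattering may not be
negligible against ε = e^(−1/2GT) for any threshold M(T); exotic weak steady families.)
[BonettoLebowitzReyBellet2000, BasileBernardinOlla2009, LeadbetterLindgrenRootzen1983,
GaspardGilbert2008, ProsenRobnik1992]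
#2 KineticUpperBound (crux) — NORMAL TRANSPORT ON THE KINETIC WINDOW (card item 3, sharpened): ∀ ω₂
γ > 0 ∃ C ∀ L > 0 ∃ T₀ > 0 ∀ T ∈ (0, T₀) ∃ M ∀ m ≥ M: for P_m, N = ⌈L/ε(T)⌉ + 1, every weak-steady
family μ(T_L, T_R) and every D with totalCurrent(μ_(T+δ/2,T−δ/2))/δ → D (δ → 0, δ ≠ 0): ε(T)·D ≤ C,
C independent of L — the current-carrying (odd, flow-invariant) Gaussian perturbations relax at rate
≍ ε under the rare collisions although each collision differs from the free turnaround only through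
the Palm tilt; equivalently the first-order Palm-mismatch collision operator has a gap on the odd
sector and the Boltzmann slab with Langevin contacts has bounded conductance ε·D → K(L) ≤ κ₁.
[difficulty: XL] (why it might fail: Collisions are equilibrium-invisible at leading order (up-Palm
↦ down-Palm identity); if the first-order Palm-tilt operator merely rotates odd perturbations
without decay, relaxation appears only at relative order T/b² = (2G·log ε⁻¹)⁻¹ and ε·D ~ log(1/ε) →
∞.) [BasileOllaSpohn2009, BasileBernardinOlla2009, BasileBernardinJaraKomorowskiOlla2016,
Lanford1975, LeadbetterLindgrenRootzen1983, Aldous1989, KomorowskiOlla2020]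
#3 SpaceTimeExcursionPoisson (crux) — THE RANDOMNESS (card item 2 in the space-time form asked by
the novelty audit): for the FREE pinned harmonic chain pinnedChain ω₂ 0 0 γ, every family of
shift-invariant DLR Gibbs states μ_T with μ_T-preserving infinite-volume dynamics D_T on an
exponentially tempered carrier (InfiniteChainDynamics, IsChainGibbsMeasure, PreservesMeasure,
expTempered — then μ_T = N(0, TΦ⁻¹) and D_T is the harmonic flow a.e.), every k blocks of bonds
⌊y_i/ε(T)⌋ + x (|x| ≤ K, y_i distinct reals: macroscopic separation), every grid of rescaled time
cells [jθ/ε, (j+1)θ/ε), j < J: the joint law of the numbers of OUTWARD hits (|r| = 1, r·ṙ > 0, r =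
q_(x+1) − q_x) in the cells converges as T → 0⁺ to i.i.d. Poisson(θ) — independent rate-1 Poisson
streams per bond in the time scale 1/ε(T), asymptotically independent across macroscopically
separated blocks (Rice normalisation ε = π⁻¹√(2/G)e^(−1/2GT) exact; Berman mixing from the t^(−1/2)
/ t^(−1/3) decay of Cov(r_0(0), r_x(t)); no clustering in the limit since sup over distinct events
of the correlation is < 1). [difficulty: L] (why it might fail: Aftershock clustering: a new
excursion one quasi-period after a hit has probability ε^((1−ρ)/(1+ρ)), ρ = sup_(t≥t₀) Corr(r_x(0),
r_x(t)) < 1 needed; if ρ = 1 recurs along some space-time direction (degenerate dispersion) the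
limit is compound Poisson, not Poisson.) [Berman1971, Qualls1968, LeadbetterLindgrenRootzen1983,
Piterbarg2012, Aldous1989, RiederLebowitzLieb1967, LanfordLebowitzLieb1977]
#4 KineticLowerBound (crux) — COLLISIONS CANNOT DO MORE THAN RATE ε (Arrhenius divergence, the
honest record of the ballistic end point): ∀ ω₂ γ > 0 ∃ c > 0 ∀ L ≥ 1 ∃ T₀ > 0 ∀ T ∈ (0, T₀) ∃ M ∀ m
≥ M: for P_m, N = ⌈L/ε(T)⌉ + 1, every weak-steady family and every response limit D: c ≤ ε(T)·D —
the harmonic mode energies are broken only at hits (rate ε per bond, O(1) relative effect per hit at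
first order), so a Mazur-type bound with slowly broken charges / a variational (Thomson–Dirichlet)
bound for the kinetic slab gives conductance ≥ c/ε; L ≥ 1 keeps away from the contact-dominated
ballistic regime ε·D ≈ c_∞L. [difficulty: L] (why it might fail: At finite m the smooth wall r^(2m)
also scatters thermal phonons; its Gaussian moments (4mGT/e)^(2m) are extremised exactly at the
Arrhenius scale, so no threshold M(T) might make that leakage o(ε) — then only the m = ∞ hard tether
obeys the bound and the item must be restated for it.) [Mazur1969, RiederLebowitzLieb1967,
BonettoLebowitzReyBellet2000, GendelmanSavin2016, BhattacharyyaKumarpatra2020, ProsenRobnik1992]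
#9 TetheredSmoothFamily (support) — A DIFFERENTIABLE STEADY FAMILY EXISTS (clause (a) of the target;
makes the two bounds non-vacuous without weak-class uniqueness): for ω₂, γ > 0, m ≥ 2 and every N
the tethered chain P_m (harmonic pinning, polynomial coercive interaction of degree 2m ≥ pinning
degree 2: Cuneo–Eckmann–Hairer–Rey-Bellet conditions C1–C5) has a family μ(T_L, T_R) of weak steady
states (the invariant measures of the Langevin semigroup) whose total current is differentiable in
the bath temperatures at equilibrium: D = lim totalCurrent(μ_(T+δ/2,T−δ/2))/δ exists for every T > 0
(finite-volume Green–Kubo, ReyBellet2003 Rem. 4.4). Adapt the tree's proof of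
CuneoEckmannHairerReyBellet2018_pinnedChain_holds (LangevinChain* files) from degree 4 to degree 2m.
[difficulty: L] [CuneoEckmannHairerReyBellet2018, Carmona2007, ReyBellet2003,
EckmannPilletReyBellet1999b]

TWO-LAYER PLAN. Foreseen glued splits (k ≤ 3, depth 1; nothing filed now). KineticUpperBound ⇐
MarkedExcursionPoisson (SpaceTimeExcursionPoisson with Slepian/Palm marks: the local field at hits
converges to bump + Rayleigh·w + conditioned Gaussian) → PalmBoltzmannLimit (informal crux 5, filed
after open: kinetic limit on kinetic times [0, τ₀/ε] for the hard tether, covariance/Wigner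
perturbations evolve by ∂_τW + (ω′/2π)∂_yW = 𝒦W with 𝒦 the Palm-mismatch operator, dissipative with
a gap on the odd sector; needs definitions hardTetherDynamics, palmMismatchOperator) →
SteadyStateTimeExchange (from kinetic times to the NESS of the N = L/ε slab: relaxation on the
window's own diffusive scale ε⁻¹L², contacts as Langevin boundary conditions, then the steep-wall
limit m → ∞ at fixed T). KineticLowerBound ⇐ SlowlyBrokenCharges (mode energies change only at hits:
d/dt of the harmonic actions is supported on hit times, rate ε) → MazurWithLeakage (Mazur1969-type
inequality with charges conserved up to rate ε gives current autocorrelation ≥ Drude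
weight·e^(−cεt), hence conductance ≥ c/ε) → OpenChainTransfer (equilibrium bound ⇒ boundary-driven
response, cf. open-chain-mazur-bridge card). SpaceTimeExcursionPoisson ⇐ single-bond Poisson limit
(Qualls/Berman for the process t ↦ r_0(t)) → multi-bond asymptotic independence (Berman1971-type,
sup of cross-correlations < 1) → block independence at separation y/ε (mixing rate of the space-time
covariance).

KILL CRITERIA. (i) A computation (finite ring, first-order Palm operator, see § Cheapest falsifier)
or equilibrium MD of the hard-tether chain showing ε·κ growing like log(1/ε) refutes
KineticUpperBound: close `refuted:KineticUpperBound` — the Arrhenius EXPONENT survives but the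
card's "κ·ε → κ₁" and the linear-Boltzmann picture die; a weaker log-corrected route would be a new
thesis, not a repair. (ii) Compound-Poisson (clustered) or non-Poisson hit statistics for the free
chain refute SpaceTimeExcursionPoisson and with it the kinetic mechanism: close. (iii) ε·D → 0 along
every steep family (finite-m leakage) refutes KineticLowerBound as filed: pivot by restating both
bounds for the hard-tether dynamics once `hardTetherDynamics` lands (same decl names, `--restate`).
(iv) An exotic (non-unique) weak steady family violating a bound is a formal kill only: restate for
the semigroup-invariant family of TetheredSmoothFamily. Proved elsewhere and mooting the route:
nothing — no other route touches this chain family.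

NOT DECOMPOSED YET. The identification layer (PalmBoltzmannLimit, the explicit operator 𝒦, K(L) → κ₁
= T⁻²⟨j, 𝒦_odd⁻¹ j⟩ and its value) waits for the two definition requests; the marked (Slepian)
version of the Poisson crux; the steep-wall (m → ∞ at fixed T, N) convergence of steady-state
responses, folded into the thresholds M(T) of every item; contact/boundary-layer constants c_∞(ω₂,
γ) of the ballistic regime L ≲ 1 (RiederLebowitzLieb1967, in tree as HarmonicChainBallisticFlux);
weak-class uniqueness of steady states for P_m (deliberately NOT asserted: bounds are stated for all
families, existence for one); the fixed-ε rung FouriersLawFor(P_m) / of the hard-tether chain (card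
item W4, ding-dong anchor ProsenRobnik1992) — a separate thesis (its m = 2 member is pinnedChain ω₂
0 4 γ, the lam = 0 sibling of the conjunct, and has nothing to do with rare collisions); the
soft-tether bridge to pinnedChain (card item 6) — not claimed.

CHEAPEST FALSIFIER. LINEAR ALGEBRA, kit-sized: on a ring of n = 8…32 sites take the Gibbs covariance
G = T·diag(Φ⁻¹, I) of the pinned harmonic chain, the odd flow-invariant perturbations δC (span of
the mode "angular momenta", i.e. antisymmetric q–p blocks commuting with the flow), and the
first-order Palm response per hit at bond x computed in § Why this line (ΔC = E[V²](Δσ·wᵀ + w·Δσᵀ) +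
b·E[V](Δσ·uᵀ + u·Δσᵀ) + …, averaged over x and over the free flight); check whether the induced
operator on the odd sector, symmetrised with respect to the G-inner product, is negative definite
(KineticUpperBound plausible) or has a kernel / purely imaginary part (log enhancement ⇒ refute).
Second cheapest: equilibrium MD of the hard-tether chain (event-driven between exact harmonic
flights) at 1/(2GT) ∈ {6, 9, 12}: does ε(T)·κ_GK level off? Not run this session (planner seat, no
kit in plancard mode).

NUMBERS. G(ω₂) = 1 − √(ω₂/(ω₂+4)); G(1) = 0.5528 (λ₀ = 0.553·T, matches the novelty audit); λ₂ =
Var(p_(x+1) − p_x) = 2T; Corr(r_x, r_(x+1)) = −0.309 at ω₂ = 1 (audit); Rice two-sided outward rate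
of |r| = b: ε = π⁻¹(λ₂/λ₀)^(1/2)·e^(−b²/2λ₀), activation energy E_a = b²T/(2λ₀) = b²/(2G) =
0.9045·b² at ω₂ = 1; excursion duration θ = 2Vλ₀/(bλ₂) and overshoot O(T/b) → 0; Rayleigh hit speed
E[V²] = 2λ₂ = 4T; per-hit relative mismatch to the free turnaround η = √T/b with η²·log(1/ε) =
1/(2G) = O(1) (why the log scenario is the live risk); expected clustered ("aftershock") pairs in
the kinetic window ~ ε^(−2ρ/(1+ρ)) → ∞ but a vanishing fraction ε^((1−ρ)/(1+ρ)) of all hits (why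
full-window total-variation Poisson convergence is NOT claimed). Items at open: 6 typed (target, 3
cruxes, 1 support, assembly) + 1 informal crux + 2 definition requests.

DEFINITION REQUESTS. (filed right after open) D1 `hardTetherDynamics` (topic
Literature/MathematicalPhysics/KineticTheory): the N-site pinned harmonic chain with the
holonomic-free hard tether |q_(x+1) − q_x| ≤ 1 — harmonic flow inside, momentum exchange p_x ↔
p_(x+1) at the boundary — as a measurable flow on the constrained phase space preserving the
truncated Gibbs measure, with and without Langevin baths (the m → ∞ limit object of P_m;
steep-potential billiard limit per bond). D2 `palmMismatchOperator` (same topic): the linear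
operator on flow-invariant covariance perturbations of N(0, TΦ⁻¹) (equivalently on Wigner functions
W(k)) given by the Rice-rate-weighted, Palm-averaged first-order difference between the exchange R_x
and the free turnaround e^(θA) at an outward hit of bond x, summed over x — the collision operator
of PalmBoltzmannLimit. Optional abbreviation `tetheredChain ω₂ m γ : OscillatorChain` (inlined in
every item for now). Informal crux (rank 5) PalmBoltzmannLimit filed with `workitem add --informal`
until D1/D2 land.

Novelty: Searches (2026-08-15, this session; plus the card's and the novelty audit's logs): `lit search
--source crossref` ×3 ("rare interaction limit deterministic lattice stochastic energy exchange
Gaspard Gilbert" → GaspardGilbert2008 PRL + JSTAT 2008/2009/2017 series, 12 rows; "Poisson limit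
high level upcrossings stationary Gaussian process Slepian model Berman" → Berman1971, Qualls1968,
Berman 1980 compound Poisson, Piterbarg–Stamatovic 2004, 11 rows; "harmonic chain hard core
collisions heat conduction low temperature Arrhenius" → BasileBernardinJaraKomorowskiOlla2016 only
relevant row); `lit search --source s2` ("heat conduction one-dimensional chain colliding harmonic
oscillators" → ProsenRobnik1992, GendelmanSavin2016 arXiv:1609.00564, Bhattacharyya–Patra
arXiv:1906.09967, 14 rows; second s2/arXiv/OpenAlex/zbMATH queries rate-limited 429, local FTS
daemon reset — recorded in NOTES); `lit galaxy search --star all` ×2 ("colliding harmonic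
oscillators": 3 book rows, none relevant; "Slepian model": Aldous1989 Poisson clumping, Lindgren
"Stationary Stochastic Processes", Hüsler–Reiss EVT proceedings, Lindgren Slepian sea-wave papers —
the EVT toolbox exists in books, no transport application); `lit read arXiv:1906.09967` pp. 1–2 (φ⁴
chain + soft-sphere collisions, numerics, Fourier holds, κ_φ4C ≪ κ_φ4 at low T); `lit frontier
AtomisticToContinuum --since 2020` (30 rows: CanestrariLiveraniOlla2026 Inventiones "Heat equation
from a deterministic dynamics" the only transport-from-de  [refs: 10.1103/physrevlett.101.020601, 1609.00564, 1906.09967, 2604.14056, 1510.06408, 2310.13338, doi:10.1103/physrevlett.101.020601, GaspardGilbert2008, Berman1971, Qualls1968, BasileBernardinJaraKomorowskiOlla2016, ProsenRobnik1992, GendelmanSavin2016, Aldous1989, CanestrariLiveraniOlla2026, BalintEtAl2015, BhattacharyyaKumarpatra2020, LeadbetterLindgrenRootzen1983]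

Barriers (technique_class: rare-collision-poisson-limit; gaussian-excursion-evt): - technique_class: rare-collision-poisson-limit; gaussian-excursion-evt
- Literature.Barriers.AtomisticToContinuum.HarmonicChainBallisticFlux: met head-on and recorded, not
evaded: the ε = 0 end point is the ballistic harmonic chain and KineticLowerBound states the
divergence D ≥ c/ε; the statements live on the joint window N ≍ 1/ε where each phonon meets O(1)
collisions, exactly as the (λT)⁻² corner of LowTemperatureWeakAnharmonicity.
- Literature.Barriers.AtomisticToContinuum.LowTemperatureWeakAnharmonicity: the route is NOT
perturbative in a smooth coupling: at fixed finite m the low-T corner is that barrier's regime (m =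
2 is pinnedChain ω₂ 0 4 γ), which is why every item takes m ≥ M(T) → ∞ (hard tether first); the
small parameter is a RATE e^(−1/2GT), not a coupling, and the expansion is in the number of
collisions.
- Literature.Barriers.AtomisticToContinuum.MacroErgodicityBarrier: not assumed and not proved at
fixed ε; the bet is that on the kinetic window the deterministic chain acquires a Markov
(linear-Boltzmann) description whose limit dynamics is macro-ergodic (FritzFunakiLebowitz1994 /
Bernardin2014 for exchange models) — an evasion by passage to the rare-collision limit;
SteadyStateTimeExchange (layer 2) is where the barrier bites.
- Literature.Barriers.AtomisticToContinuum.Mazur1969_inequality: used as a RESOURCE on the lower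
side (charges broken at rate ε ⇒ D ≥ c/ε); on the upper side the check in § Why this line shows no
odd flow-invariant Gaussian perturbatio

History (route lifecycle, newest last):
- 2026-08-15T13:41:18Z · CLOSED retired — not-a-thesis: assembly does not conclude the sub-problem Statement (operator:999:1257524)

sub-problem: FouriersLaw · status: closed(retired) · opened planner-plancard-AtomisticToContinuum-Fourier-b7e01b51-0 2026-08-15T11:48:16Z · rev 0 · ledger route-AtomisticToContinuum-CollisionNoise
GENERATED by the gate from the ledger (D-0016/17). Provers cite these decls: `theorem foo : Summit.AtomisticToContinuum.FouriersLaw.Theses.CollisionNoise.<Decl> := …` in Summits/AtomisticToContinuum/FouriersLaw/Theorems/<Name>.lean.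
-/

namespace Summit.AtomisticToContinuum.FouriersLaw.Theses.CollisionNoise

open scoped BigOperators Topology Manifold Classical MeasureTheory ProbabilityTheory Matrix InnerProductSpace ComplexConjugate ContinuousMap
open Filter Set Function TopologicalSpace MeasureTheory

attribute [summit_statement] _root_.FouriersLaw

/-- item stmt-AtomisticToContinuum-6562 · target · rank 0 · closed · moot by None · by planner
why it might fail: Upper side: the first-order Palm collision operator may be non-dissipative on the odd sector, giving εD ~ log(1/ε) → ∞; lower side/finite m: smooth-wall multi-phonon scattering may not be negligible against ε = e^(−1/2GT) for any threshold M(T); exotic weak steady families.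
sources: BonettoLebowitzReyBellet2000, BasileBernardinOlla2009, LeadbetterLindgrenRootzen1983, GaspardGilbert2008, ProsenRobnik1992
[target] X as in § Thesis: ∀ ω₂ γ > 0 ∃ 0 < c, C ∀ L ≥ 1 ∃ T₀ ∀ T ∈ (0, T₀) ∃ M ∀ m ≥ M, with P =
P_m, ε = Rice rate, N = ⌈L/ε(T)⌉ + 1: (a) some steady family (IsSteadyState at all T_L, T_R > 0) has
a response limit D = lim_(δ→0, δ≠0) totalCurrent(μ_(T+δ/2, T−δ/2))/δ; (b) every response limit of
every steady family satisfies c ≤ ε(T)·D ≤ C. -/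
@[route_item "route-AtomisticToContinuum-CollisionNoise"]
def ArrheniusWindowLaw : Prop :=
  ∀ ω₂ γ : ℝ, 0 < ω₂ → 0 < γ → ∀ G : ℝ, G = 1 - Real.sqrt (ω₂ / (ω₂ + 4)) → ∀ ε : ℝ → ℝ, (∀ T, ε T = Real.exp (-(1 / (2 * G * T))) * Real.sqrt (2 / G) / Real.pi) → ∃ c C : ℝ, 0 < c ∧ ∀ L : ℝ, 1 ≤ L → ∃ T₀ : ℝ, 0 < T₀ ∧ ∀ T : ℝ, 0 < T → T < T₀ → ∃ M : ℕ, ∀ m : ℕ, M ≤ m → ∀ P : Literature.MathematicalPhysics.KineticTheory.HeatConduction.OscillatorChain, P = ⟨fun q => ω₂ * q ^ 2 / 2, fun r => r ^ 2 / 2 + r ^ (2 * m), γ⟩ → ∀ N : ℕ, N = ⌈L / ε T⌉₊ + 1 → (∃ μ : ℝ → ℝ → MeasureTheory.Measure (Literature.MathematicalPhysics.KineticTheory.HeatConduction.PhaseSpace N), (∀ T_L T_R : ℝ, 0 < T_L → 0 < T_R → P.IsSteadyState N T_L T_R (μ T_L T_R)) ∧ ∃ D : ℝ, Filter.Tendsto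 (fun δ : ℝ => P.totalCurrent (μ (T + δ / 2) (T - δ / 2)) / δ) (nhdsWithin 0 {(0 : ℝ)}ᶜ) (nhds D)) ∧ ∀ (μ : ℝ → ℝ → MeasureTheory.Measure (Literature.MathematicalPhysics.KineticTheory.HeatConduction.PhaseSpace N)) (D : ℝ), (∀ T_L T_R : ℝ, 0 < T_L → 0 < T_R → P.IsSteadyState N T_L T_R (μ T_L T_R)) → Filter.Tendsto (fun δ : ℝ => P.totalCurrent (μ (T + δ / 2) (T - δ / 2)) / δ) (nhdsWithin 0 {(0 : ℝ)}ᶜ) (nhds D) → c ≤ ε T * D ∧ ε T * D ≤ C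

/-- item stmt-AtomisticToContinuum-6563 · crux · rank 2 · closed · moot by None · by planner
why it might fail: Collisions are equilibrium-invisible at leading order (up-Palm ↦ down-Palm identity); if the first-order Palm-tilt operator merely rotates odd perturbations without decay, relaxation appears only at relative order T/b² = (2G·log ε⁻¹)⁻¹ and ε·D ~ log(1/ε) → ∞.
sources: BasileOllaSpohn2009, BasileBernardinOlla2009, BasileBernardinJaraKomorowskiOlla2016, Lanford1975, LeadbetterLindgrenRootzen1983, Aldous1989
[crux] NORMAL TRANSPORT ON THE KINETIC WINDOW (card item 3, sharpened): ∀ ω₂ γ > 0 ∃ C ∀ L > 0 ∃ T₀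
> 0 ∀ T ∈ (0, T₀) ∃ M ∀ m ≥ M: for P_m, N = ⌈L/ε(T)⌉ + 1, every weak-steady family μ(T_L, T_R) and
every D with totalCurrent(μ_(T+δ/2,T−δ/2))/δ → D (δ → 0, δ ≠ 0): ε(T)·D ≤ C, C independent of L —
the current-carrying (odd, flow-invariant) Gaussian perturbations relax at rate ≍ ε under the rare
collisions although each collision differs from the free turnaround only through the Palm tilt;
equivalently the first-order Palm-mismatch collision operator has a gap on the odd sector and the
Boltzmann slab with Langevin contacts has bounded conductance ε·D → K(L) ≤ κ₁. [difficulty: XL] -/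
@[route_item "route-AtomisticToContinuum-CollisionNoise"]
def KineticUpperBound : Prop :=
  ∀ ω₂ γ : ℝ, 0 < ω₂ → 0 < γ → ∀ G : ℝ, G = 1 - Real.sqrt (ω₂ / (ω₂ + 4)) → ∀ ε : ℝ → ℝ, (∀ T, ε T = Real.exp (-(1 / (2 * G * T))) * Real.sqrt (2 / G) / Real.pi) → ∃ C : ℝ, ∀ L : ℝ, 0 < L → ∃ T₀ : ℝ, 0 < T₀ ∧ ∀ T : ℝ, 0 < T → T < T₀ → ∃ M : ℕ, ∀ m : ℕ, M ≤ m → ∀ P : Literature.MathematicalPhysics.KineticTheory.HeatConduction.OscillatorChain, P = ⟨fun q => ω₂ * q ^ 2 / 2, fun r => r ^ 2 / 2 + r ^ (2 * m), γ⟩ → ∀ N : ℕ, N = ⌈L / ε T⌉₊ + 1 → ∀ (μ : ℝ → ℝ → MeasureTheory.Measure (Literature.MathematicalPhysics.KineticTheory.HeatConduction.PhaseSpace N)) (D : ℝ), (∀ T_L T_R : ℝ, 0 < T_L → 0 < T_R → P.IsSteadyState N T_L T_R (μ T_L T_R)) → Filter.Tendsto (fun δ : ℝ => P.totalCurrent (μ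 (T + δ / 2) (T - δ / 2)) / δ) (nhdsWithin 0 {(0 : ℝ)}ᶜ) (nhds D) → ε T * D ≤ C

/-- item stmt-AtomisticToContinuum-6564 · crux · rank 3 · closed · moot by None · by planner
why it might fail: Aftershock clustering: a new excursion one quasi-period after a hit has probability ε^((1−ρ)/(1+ρ)), ρ = sup_(t≥t₀) Corr(r_x(0), r_x(t)) < 1 needed; if ρ = 1 recurs along some space-time direction (degenerate dispersion) the limit is compound Poisson, not Poisson.
sources: Berman1971, Qualls1968, LeadbetterLindgrenRootzen1983, Piterbarg2012, Aldous1989, RiederLebowitzLieb1967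
[crux] THE RANDOMNESS (card item 2 in the space-time form asked by the novelty audit): for the FREE
pinned harmonic chain pinnedChain ω₂ 0 0 γ, every family of shift-invariant DLR Gibbs states μ_T
with μ_T-preserving infinite-volume dynamics D_T on an exponentially tempered carrier
(InfiniteChainDynamics, IsChainGibbsMeasure, PreservesMeasure, expTempered — then μ_T = N(0, TΦ⁻¹)
and D_T is the harmonic flow a.e.), every k blocks of bonds ⌊y_i/ε(T)⌋ + x (|x| ≤ K, y_i distinct
reals: macroscopic separation), every grid of rescaled time cells [jθ/ε, (j+1)θ/ε), j < J: the joint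
law of the numbers of OUTWARD hits (|r| = 1, r·ṙ > 0, r = q_(x+1) − q_x) in the cells converges as T
→ 0⁺ to i.i.d. Poisson(θ) — independent rate-1 Poisson streams per bond in the time scale 1/ε(T),
asymptotically independent across macroscopically separated blocks (Rice normalisation ε =
π⁻¹√(2/G)e^(−1/2GT) exact; Berman mixing from the t^(−1/2) / t^(−1/3) decay of Cov(r_0(0), r_x(t));
no clustering in the limit since sup over distinct events of the correlation is < 1). [difficulty:
L] -/
@[route_item "route-AtomisticToContinuum-CollisionNoise"]
def SpaceTimeExcursionPoisson : Prop :=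
  ∀ ω₂ γ : ℝ, 0 < ω₂ → ∀ G : ℝ, G = 1 - Real.sqrt (ω₂ / (ω₂ + 4)) → ∀ ε : ℝ → ℝ, (∀ T, ε T = Real.exp (-(1 / (2 * G * T))) * Real.sqrt (2 / G) / Real.pi) → ∀ (μ : ℝ → MeasureTheory.Measure Literature.MathematicalPhysics.KineticTheory.HeatConduction.ChainConfig) (D : ℝ → Literature.MathematicalPhysics.KineticTheory.HeatConduction.InfiniteChainDynamics (Literature.MathematicalPhysics.KineticTheory.HeatConduction.pinnedChain ω₂ 0 0 γ)), (∀ T : ℝ, 0 < T → (Literature.MathematicalPhysics.KineticTheory.HeatConduction.pinnedChain ω₂ 0 0 γ).IsChainGibbsMeasure T (μ T) ∧ (μ T).map (fun (σ : Literature.MathematicalPhysics.KineticTheory.HeatConduction.ChainConfig) (x : ℤ) => σ (x + 1)) = μ T ∧ (D T).PreservesMeasure (μ T) ∧ ∃ r : ℝ, (D T).carrier ⊆ (Literature.MathematicalPhysics.KineticTheory.HeatConduction.pinnedChain ω₂ 0 0 γ).expTempered r) → ∀ (k K J : ℕ) (θ : ℝ), 0 < θ → ∀ y : Fin k → ℝ,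 Function.Injective y → ∀ n : Fin k → ℤ → ℕ → ℕ, Filter.Tendsto (fun T : ℝ => μ T {σ | ∀ (i : Fin k) (x : ℤ), |x| ≤ (K : ℤ) → ∀ j : ℕ, j < J → Set.ncard {t : ℝ | t ∈ Set.Ico ((j : ℝ) * θ / ε T) (((j : ℝ) + 1) * θ / ε T) ∧ |((D T).flow t σ (⌊y i / ε T⌋ + x + 1)).1 - ((D T).flow t σ (⌊y i / ε T⌋ + x)).1| = 1 ∧ 0 < (((D T).flow t σ (⌊y i / ε T⌋ + x + 1)).1 - ((D T).flow t σ (⌊y i / ε T⌋ + x)).1) * (((D T).flow t σ (⌊y i / ε T⌋ + x + 1)).2 - ((D T).flow t σ (⌊y i / ε T⌋ + x)).2)} = n i x j}) (nhdsWithin 0 (Set.Ioi 0)) (nhds (ENNReal.ofReal (∏ i : Fin k, ∏ x ∈ Finset.Icc (-(K : ℤ)) K, ∏ j ∈ Finset.range J, (Real.exp (-θ) * θ ^ (n i x j) / ((n i x j).factorial : ℝ)))))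

/-- item stmt-AtomisticToContinuum-6565 · crux · rank 4 · closed · moot by None · by planner
why it might fail: At finite m the smooth wall r^(2m) also scatters thermal phonons; its Gaussian moments (4mGT/e)^(2m) are extremised exactly at the Arrhenius scale, so no threshold M(T) might make that leakage o(ε) — then only the m = ∞ hard tether obeys the bound and the item must be restated for it.
sources: Mazur1969, RiederLebowitzLieb1967, BonettoLebowitzReyBellet2000, GendelmanSavin2016, BhattacharyyaKumarpatra2020, ProsenRobnik1992
[crux] COLLISIONS CANNOT DO MORE THAN RATE ε (Arrhenius divergence, the honest record of the
ballistic end point): ∀ ω₂ γ > 0 ∃ c > 0 ∀ L ≥ 1 ∃ T₀ > 0 ∀ T ∈ (0, T₀) ∃ M ∀ m ≥ M: for P_m, N =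
⌈L/ε(T)⌉ + 1, every weak-steady family and every response limit D: c ≤ ε(T)·D — the harmonic mode
energies are broken only at hits (rate ε per bond, O(1) relative effect per hit at first order), so
a Mazur-type bound with slowly broken charges / a variational (Thomson–Dirichlet) bound for the
kinetic slab gives conductance ≥ c/ε; L ≥ 1 keeps away from the contact-dominated ballistic regime
ε·D ≈ c_∞L. [difficulty: L] -/
@[route_item "route-AtomisticToContinuum-CollisionNoise"]
def KineticLowerBound : Prop :=
  ∀ ω₂ γ : ℝ, 0 < ω₂ → 0 < γ → ∀ G : ℝ, G = 1 - Real.sqrt (ω₂ / (ω₂ + 4)) → ∀ ε : ℝ → ℝ, (∀ T, ε T = Real.exp (-(1 / (2 * G * T))) * Real.sqrt (2 / G) / Real.pi) → ∃ c : ℝ, 0 < c ∧ ∀ L : ℝ, 1 ≤ L → ∃ T₀ : ℝ, 0 < T₀ ∧ ∀ T : ℝ, 0 < T → T < T₀ → ∃ M : ℕ, ∀ m : ℕ, M ≤ m → ∀ P : Literature.MathematicalPhysics.KineticTheory.HeatConduction.OscillatorChain, P = ⟨fun q => ω₂ * q ^ 2 / 2, fun r => r ^ 2 / 2 + r ^ (2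 * m), γ⟩ → ∀ N : ℕ, N = ⌈L / ε T⌉₊ + 1 → ∀ (μ : ℝ → ℝ → MeasureTheory.Measure (Literature.MathematicalPhysics.KineticTheory.HeatConduction.PhaseSpace N)) (D : ℝ), (∀ T_L T_R : ℝ, 0 < T_L → 0 < T_R → P.IsSteadyState N T_L T_R (μ T_L T_R)) → Filter.Tendsto (fun δ : ℝ => P.totalCurrent (μ (T + δ / 2) (T - δ / 2)) / δ) (nhdsWithin 0 {(0 : ℝ)}ᶜ) (nhds D) → c ≤ ε T * D

-- item stmt-AtomisticToContinuum-7296 · support · rank 5 · closed · moot by None · by planner — informal only, no Lean statement yet: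
--   [crux] PALM–BOLTZMANN LIMIT (identification layer; card item 3 corrected by the planner's check).
--   For the HARD-TETHER pinned harmonic chain (m = ∞: harmonic flow inside |q_(x+1) − q_x| ≤ 1, momentum
--   exchange p_x ↔ p_(x+1) at the boundary; definition request hardTetherDynamics), in equilibrium
--   (truncated Gibbs) at temperature T → 0⁺ with Rice rate ε(T) = π⁻¹√(2/G)e^(−1/2GT): (i) KINETIC LIMIT
--   ON KINETIC TIMES — for every τ₀ < ∞, flow-invariant covariance perturbations δC (equivalently phonon
--   Wigner distributions W(y, k, τ) on the scale x = y/ε, t = τ/ε) evolve in the limit by the LINEAR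
--   phonon

/-- item stmt-AtomisticToContinuum-6566 · support · rank 9 · closed · moot by None · by planner
sources: CuneoEckmannHairerReyBellet2018, Carmona2007, ReyBellet2003, EckmannPilletReyBellet1999b
[support] A DIFFERENTIABLE STEADY FAMILY EXISTS (clause (a) of the target; makes the two bounds
non-vacuous without weak-class uniqueness): for ω₂, γ > 0, m ≥ 2 and every N the tethered chain P_m
(harmonic pinning, polynomial coercive interaction of degree 2m ≥ pinning degree 2:
Cuneo–Eckmann–Hairer–Rey-Bellet conditions C1–C5) has a family μ(T_L, T_R) of weak steady states
(the invariant measures of the Langevin semigroup) whose total current is differentiable in the bath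
temperatures at equilibrium: D = lim totalCurrent(μ_(T+δ/2,T−δ/2))/δ exists for every T > 0
(finite-volume Green–Kubo, ReyBellet2003 Rem. 4.4). Adapt the tree's proof of
CuneoEckmannHairerReyBellet2018_pinnedChain_holds (LangevinChain* files) from degree 4 to degree 2m.
[difficulty: L] -/
@[route_item "route-AtomisticToContinuum-CollisionNoise"]
def TetheredSmoothFamily : Prop :=
  ∀ ω₂ γ : ℝ, 0 < ω₂ → 0 < γ → ∀ m : ℕ, 2 ≤ m → ∀ P : Literature.MathematicalPhysics.KineticTheory.HeatConduction.OscillatorChain, P = ⟨fun q => ω₂ * q ^ 2 / 2, fun r => r ^ 2 / 2 + r ^ (2 * m), γ⟩ → ∀ N : ℕ, ∃ μ : ℝ → ℝ → MeasureTheory.Measure (Literature.MathematicalPhysics.KineticTheory.HeatConduction.PhaseSpace N), (∀ T_L T_R : ℝ, 0 < T_L → 0 < T_R → P.IsSteadyState N T_L T_R (μ T_L T_R)) ∧ ∀ T : ℝ, 0 < T → ∃ D : ℝ, Filter.Tendsto (fun δ : ℝ => P.totalCurrent (μ (T + δ / 2) (T - δ / 2)) / δ) (nhdsWithin 0 {(0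 : ℝ)}ᶜ) (nhds D)

/-- item stmt-AtomisticToContinuum-6567 · assembly · rank 1 · closed · moot by None · by planner
sources: BonettoLebowitzReyBellet2000, Lanford1975
[assembly] KineticUpperBound → SpaceTimeExcursionPoisson → KineticLowerBound → TetheredSmoothFamily
→ ArrheniusWindowLaw. -/
@[route_item "route-AtomisticToContinuum-CollisionNoise"]
def Assembly : Prop :=
  KineticUpperBound → SpaceTimeExcursionPoisson → KineticLowerBound → TetheredSmoothFamily → ArrheniusWindowLaw

end Summit.AtomisticToContinuum.FouriersLaw.Theses.CollisionNoise
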